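import Summits.QuantumFields.YangMills.Theorems.ReplicaVarianceTiltHeightChiSqLOneStepWindow
import Summits.QuantumFields.YangMills.Theorems.ReplicaVarianceTiltHeightChiSqLTriangularBounded
import Literature.MathematicalPhysics.QuantumFieldTheory.Balaban1983to89.BlockAveragingEMLHaarAC

/-!
# Route `ReplicaVarianceTilt` — crux `HeightChiSqL` (stmt-QuantumFields-26133), registered stub `stub_acIntegrable`:
# the stub FOLLOWS from ONE geometric statement — the guarded exp-mean-log fibre laws of Bałaban's averaging (0.4) on `SU(2)` are
# DOMINATED by Haar measure (helper `--supports stmt-QuantumFields-26133`; the stub stays open)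

Width seat `ym-line-sfw-p2-w3` gen 21 (home cell `ym-idea-1`; R3 RECORD rung — no summit, no rung and no crux is proved here; the YM mass
gap is NOT proved by any of this).  Fifth file of the series `…HeightChiSqLAbsCont` (a.c. conjunct), `…DataProcessing`, `…OneStepWindow`
(the stub ⟺ `∫_{PlaqSmall θ(K)} w_K²·e^{β_K A} dU < ∞`), `…TriangularBounded` (dominated one-variable laws ⇒ dominated image law).

THE CHAIN (every group-theoretic / combinatorial input is the tree's `BlockAveragingHaarAC` / `BlockAveragingEMLHaarAC`, re-run with
`≤ C • Haar` in place of `≪ Haar`):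
* §1 `map_le_smul_of_restrict` — a measurable self-map that is the identity off a set `S` and whose restricted law is `≤ C • μ` has law
  `≤ (C + 1) • μ`; `map_haar_avgFun_update_le_of_guard` — the one-variable law of (0.4) in the private coordinate `g = U(β(c))` is
  `≤ (C + 1) • Haar` as soon as the GUARDED FIBRE LAW `((Haar).restrict fibreGuard).map (W ↦ ℰ.avg (fibreFamily U c W) · W)` is `≤ C • Haar`
  (two-sided translation invariance, `BlockAveragingEMLHaarAC.map_haar_avgFun_update_eq`); `map_fieldMeasure_avgFun_le_of_guard` — then
  `(dU).map Ū ≤ (C + 1)^{#coarse bonds} • dV` (bounded triangular push-forward `HeightChiSqLTriangularBounded.map_pi_le_smul_pi_of_forall` in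
  the private coordinates `centralBond`, `BlockAveragingHaarAC.isLocal_avgFun`).
* §2 `rnDeriv_le_of_le_smul`, `rnTransport_le_ae` — a Radon–Nikodym transport of a density `0 ≤ ρ ≤ 1` along a map whose image law is
  `≤ C • dV` is `≤ C` a.e.; hence the ONE-STEP RENORMALISED WEIGHT `w_K` of the series is BOUNDED a.e. (`oneStepWeight_le_ae`).
* §3 `oneStepWeightSqOnWindow_of_fibreLawBound` — a bounded `w_K` is square-integrable against `e^{β_K A} dU ≤ e^{2β_K·#plaquettes} dU` on any
  window; `stubText_of_fibreLawBound` — **the literal text of `stub_acIntegrable` follows from**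
  `∀ F K, ∃ C ≠ ⊤, ∀ U c, ((Haar).restrict (fibreGuard ℰp U c)).map (W ↦ ℰp.avg (fibreFamily U c W) · W) ≤ C • Haar`
  **on the finest lattice of the `(K+1)`-th approximation** — the QUANTITATIVE form of the tree's `T4EMLFibreAC` /
  `BlockAveragingEMLHaarAC.haar_restrict_fibreGuard_map_absolutelyContinuous` (which give `≪` only).  That statement — a uniform density
  bound for the one-variable maps `W ↦ exp(Σ_k |I|⁻¹ log(h_k W*))·W` on `{‖h_k W* − 1‖ < 1/3}` ⊆ `SU(2)` — is the ONLY thing left of the stub;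
  it is NOT proved here (route to it: Jacobian floor from `T4EMLTangentInjective` by compactness + a finite injectivity cover + Mathlib's
  `lintegral_abs_det_fderiv_eq_addHaar_image` through the charts of `T4HaarUnitaryLocalDiffeo`).
No estimate of Bałaban's is used or asserted anywhere in this file.

References: T. Bałaban, CMP 109 (1987) 249–301 [Balaban1987RG1] ((0.4) p.253); CMP 98 (1985) 17–51 [Balaban1985Averaging] ((10) p.19);
C. King, CMP 102 (1986) 649–677 [King1986] (§3.2 p.656).
-/

noncomputable section

open MeasureTheory Filter Topology Function Set
open scoped ENNReal
open Literature.MathematicalPhysics.QuantumFieldTheory.Balaban1983to89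
open Literature.MathematicalPhysics.QuantumFieldTheory.Balaban1983to89.T3ContinuumYM3Torus
open Literature.MathematicalPhysics.QuantumFieldTheory.Balaban1983to89.T3LevelShift
open Literature.MathematicalPhysics.QuantumFieldTheory.Balaban1983to89.T3UnitLawDensityEML
open Literature.MathematicalPhysics.QuantumFieldTheory.Balaban1983to89.T3UnitScaleTilt
open Literature.MathematicalPhysics.QuantumFieldTheory.Balaban1983to89.T3RestrictedUnitDensity
open Literature.MathematicalPhysics.QuantumFieldTheory.Balaban1983to89.T3TiltDescent
open Literature.MathematicalPhysics.QuantumFieldTheory.Balaban1983to89.Missing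
open Literature.MathematicalPhysics.QuantumFieldTheory.Balaban1983to89.T4Continuum
open Literature.MathematicalPhysics.QuantumFieldTheory.Balaban1983to89.BlockAveraging
open Literature.MathematicalPhysics.QuantumFieldTheory.Balaban1983to89.BlockAveragingHaarAC
open Literature.MathematicalPhysics.QuantumFieldTheory.Balaban1983to89.BlockAveragingEMLHaarAC
open Summit.QuantumFields.YangMills.Theorems.HeightChiSqLTriangularBounded

namespace Summit.QuantumFields.YangMills.Theorems.HeightChiSqLOfFibreLawBound

/-! ## §1 Dominated guarded fibre laws ⇒ dominated one-variable laws ⇒ dominated image law of (0.4) -/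

section Law

variable {α : Type*} [MeasurableSpace α] {μ : Measure α}

/-- A measurable self-map that is the identity off a set `S` and whose `S`-restricted law is `≤ C • μ` has law `≤ (C + 1) • μ`
(dominated sibling of `BlockAveragingEMLHaarAC.absolutelyContinuous_map_of_restrict`). [folklore] -/
theorem map_le_smul_of_restrict {S : Set α} {f : α → α} (hf : Measurable f) (hoff : ∀ x, x ∉ S → f x = x) {C : ℝ≥0∞}
    (hle : (μ.restrict S).map f ≤ C • μ) : μ.map f ≤ (C + 1) • μ := by
  refine Measure.le_iff.2 fun N hN => ?_
  rw [Measure.map_apply hf hN, Measure.smul_apply, smul_eq_mul, add_mul, one_mul]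
  have hsplit : f ⁻¹' N ⊆ (f ⁻¹' N ∩ S) ∪ N := by
    intro x hx
    by_cases hxS : x ∈ S
    · exact Or.inl ⟨hx, hxS⟩
    · right
      have : f x = x := hoff x hxS
      simpa [this] using hx
  have h1 : μ (f ⁻¹' N ∩ S) ≤ C * μ N := by
    have := Measure.le_iff'.1 hle N
    rw [Measure.map_apply hf hN, Measure.restrict_apply (hf hN), Measure.smul_apply, smul_eq_mul] at this
    exact this
  calc μ (f ⁻¹' N) ≤ μ ((f ⁻¹' N ∩ S) ∪ N) := measure_mono hsplit
    _ ≤ μ (f ⁻¹' N ∩ S) + μ N := measure_union_le _ _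
    _ ≤ C * μ N + μ N := add_le_add h1 le_rfl

variable {P : Params} {j : ℕ} {G : Type*} [GaugeGroup G] [MeasurableSpace G] [HaarData G] [RegularGaugeGroup G]

/-- **DOMINATED GUARDED FIBRE LAW ⇒ DOMINATED ONE-VARIABLE LAW OF (0.4)**: if `((Haar).restrict fibreGuard).map (W ↦ ℰ.avg (fibreFamily U c W)·W)
≤ C • Haar`, then the law of `g ↦ Ū(update U β(c) g)(c)` under Haar is `≤ (C + 1) • Haar` (two-sided translation invariance
`map_haar_avgFun_update_eq`, identity off the guard). [cite: Balaban1987RG1, (0.4) p.253] -/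
theorem map_haar_avgFun_update_le_of_guard [DecidableEq (PBond P j)] (hj : j + 1 ≤ P.m + P.K) (ℰ : LoopAverage G)
    (hE : ℰ.MeasurableE) (U : GaugeField P j G) (c : PBond P (j+1)) {C : ℝ≥0∞}
    (hle : ((HaarData.haar : Measure G).restrict (fibreGuard ℰ U c)).map (fun W => ℰ.avg (fibreFamily U c W) * W) ≤
      C • (HaarData.haar : Measure G)) :
    (HaarData.haar : Measure G).map (fun g => avgFun ℰ (update U (centralBond c) g) c) ≤ (C + 1) • (HaarData.haar : Measure G) := by
  rw [map_haar_avgFun_update_eq hj ℰ hE U c]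
  refine map_le_smul_of_restrict (measurable_fibreMap ℰ hE U c) (fun W hW => fibreMap_of_not_mem ℰ U c hW) ?_
  have heq : ((HaarData.haar : Measure G).restrict (fibreGuard ℰ U c)).map (fibreMap ℰ U c) =
      ((HaarData.haar : Measure G).restrict (fibreGuard ℰ U c)).map (fun W => ℰ.avg (fibreFamily U c W) * W) :=
    Measure.map_congr ((ae_restrict_iff' (measurableSet_fibreGuard ℰ U c)).mpr
      (ae_of_all _ fun W hW => fibreMap_of_mem ℰ U c hW))
  rw [heq]
  exact hle

/-- **DOMINATED GUARDED FIBRE LAWS ⇒ DOMINATED IMAGE LAW OF (0.4)** (every group with Haar data, every measurable small-loop average, every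
torus of the standing range): if every guarded fibre law is `≤ C • Haar`, the push-forward of product Haar measure under `Ū` is
`≤ (C + 1)^{#coarse bonds} • product Haar` — the bounded triangular push-forward in the private coordinates `centralBond`. [cite: Balaban1987RG1, (0.4) p.253] -/
theorem map_fieldMeasure_avgFun_le_of_guard (hj : j + 1 ≤ P.m + P.K) (ℰ : LoopAverage G) (hE : ℰ.MeasurableE) {C : ℝ≥0∞}
    (hle : ∀ (U : GaugeField P j G) (c : PBond P (j+1)),
      ((HaarData.haar : Measure G).restrict (fibreGuard ℰ U c)).map (fun W => ℰ.avg (fibreFamily U c W) * W) ≤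
        C • (HaarData.haar : Measure G)) :
    (fieldMeasure P j G).map (avgFun ℰ : GaugeField P j G → GaugeField P (j+1) G) ≤
      ((C + 1) ^ Fintype.card (PBond P (j+1))) • fieldMeasure P (j+1) G := by
  classical
  haveI : IsProbabilityMeasure (HaarData.haar : Measure G) := HaarData.isProb
  have h := map_pi_le_smul_pi_of_forall (HaarData.haar : Measure G) (isLocal_avgFun hj ℰ) (centralBond_injective hj)
    (measurable_avgFun ℰ hE) (fun _ => C + 1) (fun U c => map_haar_avgFun_update_le_of_guard hj ℰ hE U c (hle U c))
  rw [Finset.prod_const, Finset.card_univ] at h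
  exact h

end Law

/-! ## §2 A dominated image law bounds every Radon–Nikodym transport of a sub-unit density -/

section Transport

variable {α : Type*} [MeasurableSpace α]

/-- `ν ≤ C • μ` ⇒ `dν/dμ ≤ C` a.e. [folklore] -/
theorem rnDeriv_le_of_le_smul {μ ν : Measure α} [SigmaFinite μ] {C : ℝ≥0∞} (hle : ν ≤ C • μ) :
    ν.rnDeriv μ ≤ᵐ[μ] fun _ => C := by
  refine ae_le_of_forall_setLIntegral_le_of_sigmaFinite (Measure.measurable_rnDeriv _ _) fun s _ _ => ?_
  calc ∫⁻ x in s, ν.rnDeriv μ x ∂μ ≤ ν s := Measure.setLIntegral_rnDeriv_le s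
    _ ≤ (C • μ) s := Measure.le_iff'.1 hle s
    _ = ∫⁻ _ in s, C ∂μ := by rw [Measure.smul_apply, smul_eq_mul, setLIntegral_const]

variable {P : Params} {j : ℕ} {G : Type*} [GaugeGroup G] [MeasurableSpace G] [HaarData G]

/-- **A RADON–NIKODYM TRANSPORT OF A SUB-UNIT DENSITY ALONG A MAP WITH DOMINATED IMAGE LAW IS BOUNDED A.E.**: for `0 ≤ ρ ≤ 1`
and a measurable `avg` with `(dU).map avg ≤ C • dV`, `C < ∞`, the tree's `AveragingRT.rnTransport avg ρ ≤ C` almost everywhere. [folklore] -/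
theorem rnTransport_le_ae {avg : GaugeField P j G → GaugeField P (j+1) G} (havg : Measurable avg) {ρ : Density P j G}
    (h0 : ∀ U, 0 ≤ ρ U) (h1 : ∀ U, ρ U ≤ 1) {C : ℝ≥0∞} (hC : C ≠ ⊤)
    (hle : (fieldMeasure P j G).map avg ≤ C • fieldMeasure P (j+1) G) :
    ∀ᵐ V ∂fieldMeasure P (j+1) G, AveragingRT.rnTransport avg ρ V ≤ C.toReal := by
  have hpush : AveragingRT.pushDensity avg ρ ≤ C • fieldMeasure P (j+1) G := by
    unfold AveragingRT.pushDensity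
    refine (Measure.map_mono ?_ havg).trans hle
    calc (fieldMeasure P j G).withDensity (fun U => ENNReal.ofReal (ρ U))
        ≤ (fieldMeasure P j G).withDensity (fun _ => 1) :=
          withDensity_mono (ae_of_all _ fun U => by
            show ENNReal.ofReal (ρ U) ≤ 1
            exact ENNReal.ofReal_le_one.mpr (h1 U))
      _ = fieldMeasure P j G := withDensity_one
  have hrn := rnDeriv_le_of_le_smul (μ := fieldMeasure P (j+1) G) hpush
  filter_upwards [hrn] with V hV
  have hdef : AveragingRT.rnTransport avg ρ V =
      ((AveragingRT.pushDensity avg ρ).rnDeriv (fieldMeasure P (j+1) G) V).toReal := by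
    simp only [AveragingRT.rnTransport, if_pos h0, AveragingRT.rnDensity]
  rw [hdef]
  exact ENNReal.toReal_mono hC hV

end Transport

/-! ## §3 The one-step renormalised weight is bounded, and the stub follows -/

section Stub

/-- `e^{−β A} ≥ e^{−2β·#plaquettes}`: the Wilson action is at most `2 · #plaquettes` (`|Re tr| ≤ 1`). [cite: Balaban1987RG1, (0.2) p.252] -/
theorem boltzmann_ge (P : Params) {β : ℝ} (hβ : 0 ≤ β) (U : GaugeField P 0 (Matrix.specialUnitaryGroup (Fin 2) ℂ)) :
    Real.exp (-(β * (2 * Fintype.card (Plaq P 0)))) ≤ boltzmann P β U := by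
  unfold boltzmann
  refine Real.exp_le_exp.mpr ?_
  have hA : wilsonAction4 U ≤ 2 * Fintype.card (Plaq P 0) := by
    unfold wilsonAction4 wilsonAction
    calc ∑ p : Plaq P 0, (1 : ℝ) * (1 - reTr (GaugeField.plaqHol U p)) ≤ ∑ _p : Plaq P 0, (2 : ℝ) :=
          Finset.sum_le_sum fun p _ => by
            have := (abs_le.mp (RegularGaugeGroup.abs_reTr_le_one (GaugeField.plaqHol U p))).1
            linarith
      _ = 2 * Fintype.card (Plaq P 0) := by rw [Finset.sum_const, Finset.card_univ, nsmul_eq_mul, mul_comm]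
  nlinarith

variable (F : T3Family) {γ : ℝ} (hγ : 0 ≤ γ) (K : ℕ) (θ : ℕ → ℝ)

include hγ in
/-- **THE ONE-STEP RENORMALISED WEIGHT IS BOUNDED A.E.** under dominated guarded fibre laws on the finest lattice of the `(K+1)`-th
approximation: `w_K ≤ ((C+1)^{#bonds}).toReal` for a.e. `U` on run `K`'s finest lattice (`w_K = T₀^{(K+1)}(1_{PlaqSmall θ(K+1)}·e^{−β_{K+1}A})`
read through the level identification; §1 + §2 + the measure-preserving `fieldShift`). [cite: King1986, §3.2 p.656] -/
theorem oneStepWeight_le_ae {C : ℝ≥0∞} (hC : C ≠ ⊤)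
    (hle : ∀ (U : GaugeField (F.P (K + 1)) 0 (Matrix.specialUnitaryGroup (Fin 2) ℂ)) (c : PBond (F.P (K + 1)) 1),
      ((HaarData.haar : Measure (Matrix.specialUnitaryGroup (Fin 2) ℂ)).restrict (fibreGuard ℰp U c)).map
          (fun W => ℰp.avg (fibreFamily U c W) * W) ≤ C • (HaarData.haar : Measure (Matrix.specialUnitaryGroup (Fin 2) ℂ))) :
    ∀ᵐ U ∂fieldMeasure (F.P K) 0 (Matrix.specialUnitaryGroup (Fin 2) ℂ),
      resDensity F γ (K + 1) {U' | PlaqSmall (θ (K + 1)) U'} 1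
          (fieldShift (F.sitesPerDir_eq (m := F.m) (K := K + 1) (j := 1) (m' := F.m) (K' := K) (j' := 0) (by omega)) U) ≤
        (((C + 1) ^ Fintype.card (PBond (F.P (K + 1)) 1)).toReal) := by
  have hj : 0 + 1 ≤ (F.P (K + 1)).m + (F.P (K + 1)).K := by show 0 + 1 ≤ F.m + (K + 1); omega
  -- the dominated image law of the first averaging of run `K+1`
  have himg := map_fieldMeasure_avgFun_le_of_guard (P := F.P (K + 1)) (j := 0) hj ℰp measurableE_ℰp hle
  have himg' : (fieldMeasure (F.P (K + 1)) 0 (Matrix.specialUnitaryGroup (Fin 2) ℂ)).map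
      (BlockAveraging.blockAvg (P := F.P (K + 1)) (j := 0) ℰp).avg ≤
      ((C + 1) ^ Fintype.card (PBond (F.P (K + 1)) 1)) • fieldMeasure (F.P (K + 1)) 1 (Matrix.specialUnitaryGroup (Fin 2) ℂ) := by
    rw [blockAvg_avg]; exact himg
  have hCt : (C + 1) ^ Fintype.card (PBond (F.P (K + 1)) 1) ≠ ⊤ :=
    ENNReal.pow_ne_top (ENNReal.add_ne_top.mpr ⟨hC, ENNReal.one_ne_top⟩)
  -- the initial density `1_{PlaqSmall θ(K+1)} · e^{−β_{K+1} A}` is measurable and in `[0, 1]`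
  set S' : Set (GaugeField (F.P (K + 1)) 0 (Matrix.specialUnitaryGroup (Fin 2) ℂ)) := {U' | PlaqSmall (θ (K + 1)) U'} with hS'
  set ρ : Density (F.P (K + 1)) 0 (Matrix.specialUnitaryGroup (Fin 2) ℂ) :=
    S'.indicator (boltzmann (F.P (K + 1)) ((F.scheme ℰp γ).β (K + 1))) with hρ
  have hρ0 : ∀ U, 0 ≤ ρ U := indicator_boltzmann_nonneg F γ (K + 1) S'
  have hρ1 : ∀ U, ρ U ≤ 1 := fun U => by
    refine Set.indicator_le' (fun U' _ => ?_) (fun _ _ => zero_le_one) U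
    exact boltzmann_le_one _ (F.scheme_β_nonneg ℰp hγ (K + 1)) U'
  have hT := rnTransport_le_ae (measurable_blockAvg F (K + 1) 0) hρ0 hρ1 hCt himg'
  -- `w_K` is that transport (definitional unfolding of `resDensity`/`towerDensity`/`rt`)
  have hw : ∀ V, resDensity F γ (K + 1) S' 1 V =
      AveragingRT.rnTransport (BlockAveraging.blockAvg (P := F.P (K + 1)) (j := 0) ℰp).avg ρ V := fun V => by
    show towerDensity F (K + 1) ρ (0 + 1) V = _
    rw [towerDensity_succ F (K + 1) ρ hj, towerDensity_zero]
    rfl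
  have hfs := (measurePreserving_fieldShift (G := Matrix.specialUnitaryGroup (Fin 2) ℂ)
    (F.sitesPerDir_eq (m := F.m) (K := K + 1) (j := 1) (m' := F.m) (K' := K) (j' := 0) (by omega))).quasiMeasurePreserving.ae hT
  filter_upwards [hfs] with U hU
  rw [hw]
  exact hU

include hγ in
/-- **SQUARE-INTEGRABILITY OF `w_K` ON ANY WINDOW from dominated guarded fibre laws**: a bounded `w_K` against `e^{β_K A} dU ≤ e^{2β_K·#plaq} dU`
on a probability space. [cite: King1986, §3.2 p.656] -/
theorem oneStepWeightSqOn_of_fibreLawBound (S : Set (GaugeField (F.P K) 0 (Matrix.specialUnitaryGroup (Fin 2) ℂ)))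
    (hS : MeasurableSet S) {C : ℝ≥0∞} (hC : C ≠ ⊤)
    (hle : ∀ (U : GaugeField (F.P (K + 1)) 0 (Matrix.specialUnitaryGroup (Fin 2) ℂ)) (c : PBond (F.P (K + 1)) 1),
      ((HaarData.haar : Measure (Matrix.specialUnitaryGroup (Fin 2) ℂ)).restrict (fibreGuard ℰp U c)).map
          (fun W => ℰp.avg (fibreFamily U c W) * W) ≤ C • (HaarData.haar : Measure (Matrix.specialUnitaryGroup (Fin 2) ℂ))) :
    Integrable (S.indicator fun U =>
        resDensity F γ (K + 1) {U' | PlaqSmall (θ (K + 1)) U'} 1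
            (fieldShift (F.sitesPerDir_eq (m := F.m) (K := K + 1) (j := 1) (m' := F.m) (K' := K) (j' := 0) (by omega)) U) ^ 2 /
          boltzmann (F.P K) ((F.scheme ℰp γ).β K) U)
      (fieldMeasure (F.P K) 0 (Matrix.specialUnitaryGroup (Fin 2) ℂ)) := by
  set M : ℝ := ((C + 1) ^ Fintype.card (PBond (F.P (K + 1)) 1)).toReal with hM
  set B : ℝ := Real.exp (-((F.scheme ℰp γ).β K * (2 * Fintype.card (Plaq (F.P K) 0)))) with hB
  have hB0 : 0 < B := Real.exp_pos _
  have hbd := oneStepWeight_le_ae F hγ K θ hC hle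
  have hwm := LogComparisonOneTower.measurable_oneStepWeight F γ K θ
  have hbm : Measurable fun U : GaugeField (F.P K) 0 (Matrix.specialUnitaryGroup (Fin 2) ℂ) =>
      boltzmann (F.P K) ((F.scheme ℰp γ).β K) U := measurable_boltzmann RegularGaugeGroup.measurable_reTr _ _
  have hgm := ((hwm.pow_const 2).div hbm).indicator hS
  refine ⟨hgm.aestronglyMeasurable, ?_⟩
  refine (hasFiniteIntegral_const (M ^ 2 / B)).mono ?_
  filter_upwards [hbd] with U hU
  have hw0 := LogComparisonOneTower.oneStepWeight_nonneg F γ K θ U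
  have hb := boltzmann_ge (F.P K) (F.scheme_β_nonneg ℰp hγ K) U
  have hbpos := boltzmann_pos (F.P K) ((F.scheme ℰp γ).β K) U
  have hq : resDensity F γ (K + 1) {U' | PlaqSmall (θ (K + 1)) U'} 1
        (fieldShift (F.sitesPerDir_eq (m := F.m) (K := K + 1) (j := 1) (m' := F.m) (K' := K) (j' := 0) (by omega)) U) ^ 2 /
      boltzmann (F.P K) ((F.scheme ℰp γ).β K) U ≤ M ^ 2 / B := by
    have hnum : resDensity F γ (K + 1) {U' | PlaqSmall (θ (K + 1)) U'} 1
        (fieldShift (F.sitesPerDir_eq (m := F.m) (K := K + 1) (j := 1) (m' := F.m) (K' := K) (j' := 0) (by omega)) U) ^ 2 ≤ M ^ 2 :=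
      pow_le_pow_left₀ hw0 hU 2
    calc _ ≤ M ^ 2 / boltzmann (F.P K) ((F.scheme ℰp γ).β K) U := div_le_div_of_nonneg_right hnum hbpos.le
      _ ≤ M ^ 2 / B := div_le_div_of_nonneg_left (sq_nonneg _) hB0 hb
  have hnn : 0 ≤ resDensity F γ (K + 1) {U' | PlaqSmall (θ (K + 1)) U'} 1
        (fieldShift (F.sitesPerDir_eq (m := F.m) (K := K + 1) (j := 1) (m' := F.m) (K' := K) (j' := 0) (by omega)) U) ^ 2 /
      boltzmann (F.P K) ((F.scheme ℰp γ).β K) U := div_nonneg (sq_nonneg _) hbpos.le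
  have hMB : 0 ≤ M ^ 2 / B := div_nonneg (sq_nonneg _) hB0.le
  rw [Real.norm_eq_abs, Real.norm_eq_abs, abs_of_nonneg hMB]
  by_cases hUS : U ∈ S
  · rw [Set.indicator_of_mem hUS, abs_of_nonneg hnn]
    exact hq
  · rw [Set.indicator_of_notMem hUS, abs_zero]
    exact hMB

/-- **`stub_acIntegrable` ⇐ DOMINATED GUARDED EXP-MEAN-LOG FIBRE LAWS ON `SU(2)`**: if on the finest lattice of every approximation the guarded
fibre laws of Bałaban's (0.4) with the printed small-loop average are uniformly dominated by Haar measure, the literal text of the registered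
stub holds (`…OneStepWindow.stubText_of_oneStepWeightSqOnWindow` + §3).  The hypothesis is the QUANTITATIVE form of the tree's
`BlockAveragingEMLHaarAC.haar_restrict_fibreGuard_map_absolutelyContinuous` and is NOT proved here. [cite: King1986, §3.2 p.656] -/
theorem stubText_of_fibreLawBound
    (hQ : ∀ (F : T3Family) (K : ℕ), ∃ C : ℝ≥0∞, C ≠ ⊤ ∧
      ∀ (U : GaugeField (F.P (K + 1)) 0 (Matrix.specialUnitaryGroup (Fin 2) ℂ)) (c : PBond (F.P (K + 1)) 1),
        ((HaarData.haar : Measure (Matrix.specialUnitaryGroup (Fin 2) ℂ)).restrict (fibreGuard ℰp U c)).map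
            (fun W => ℰp.avg (fibreFamily U c W) * W) ≤ C • (HaarData.haar : Measure (Matrix.specialUnitaryGroup (Fin 2) ℂ))) :
    ∀ (L : ℕ) (b₀ p₀ : ℝ), 0 < b₀ → 2 < p₀ → ∀ (m : ℕ), 0 < m → ∃ γ₁ : ℝ, 0 < γ₁ ∧
      ∀ (F : T3Family) (γ : ℝ), F.L = L → 0 < γ → γ ≤ γ₁ → ∀ K : ℕ,
        (∀ᵐ V ∂fieldMeasure (F.P (K / m)) 0 (Matrix.specialUnitaryGroup (Fin 2) ℂ), heightDensity F γ (Nat.div_le_self K m) (histGood F ℰp (θBal F.L γ b₀ p₀) K (K / m)) V = 0 → heightDensity F γ ((Nat.div_le_self K m).trans (Nat.le_succ K)) (histGood F ℰp (θBal F.L γ b₀ p₀) (K + 1) (K / m)) V = 0) ∧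
        Integrable (fun V => heightDensity F γ ((Nat.div_le_self K m).trans (Nat.le_succ K)) (histGood F ℰp (θBal F.L γ b₀ p₀) (K + 1) (K / m)) V ^ 2 / heightDensity F γ (Nat.div_le_self K m) (histGood F ℰp (θBal F.L γ b₀ p₀) K (K / m)) V) (fieldMeasure (F.P (K / m)) 0 (Matrix.specialUnitaryGroup (Fin 2) ℂ)) := by
  refine HeightChiSqLOneStepWindow.stubText_of_oneStepWeightSqOnWindow fun L b₀ p₀ _ _ => ⟨1, one_pos, fun F γ _ hγ _ K => ?_⟩
  obtain ⟨C, hC, hle⟩ := hQ F K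
  exact oneStepWeightSqOn_of_fibreLawBound F hγ.le K (θBal F.L γ b₀ p₀) _
    (measurableSet_histGood F ℰp measurableE_ℰp (θBal F.L γ b₀ p₀) K K) hC hle

end Stub

end Summit.QuantumFields.YangMills.Theorems.HeightChiSqLOfFibreLawBound

end
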